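import Summits.HodgeConjecture.HodgeConjecture.Theorems.ThreefoldSquareCodimTwoChowZero
import Literature.AlgebraicGeometry.HodgeTheory.BettiKunnethPiecesHardLefschetzReduction
import Literature.AlgebraicGeometry.HodgeTheory.HodgeConjectureProductsOddHypersurfacesSupportedMiddle
import Literature.AlgebraicGeometry.HodgeTheory.MaxRationalSubHodgeStructureKunnethDecomposition
import Literature.AlgebraicGeometry.HodgeTheory.MaxRationalSubHodgeStructureSupportedHodgeClasses
import Literature.AlgebraicGeometry.HodgeTheory.KunnethComponentsDiagonalAlgebraicPart
import Literature.AlgebraicGeometry.HodgeTheory.ComplexConjugationHolds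
import Literature.AlgebraicGeometry.Motives.HodgeTensorFactsHolds
import HarnessLib

/-!
# The additive-coniveau product theorem: `HC(Y × Z)` from coniveau PROFILES of the factors; products of up to three varieties with
# «half coniveau» (curves, surfaces with `H² = N¹`, threefolds with `H² = N¹ ∧ N¹H³ = H³`, e.g. rationally chain connected ones);
# the honest ceiling at four factors (cell `hodge-nonav`, sector SQ3, targets (xi) «triple products» + (xiii) «additive-coniveau master»)

PROVENANCE. Cell hodge-nonav (HUMAN RULING D-0038), planner p1 g35 targets (xi) (GO 2026-08-28T08:03:35Z) and (xiii) «ADDITIVE-CONIVEAU PRODUCT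
THEOREM» (same line), prover seat `hodge-nonav-19716-p2` (g3); one master of which the seat's `Theorems/ThreefoldConiveauOneOddPieces` (p614259:
two threefolds, curve × threefold) and `Theorems/ThreefoldTimesSurfaceConiveau` (p614958: threefold × surface) are instances. SUPPORT FILE
(`--supports stmt-HodgeConjecture-19654 --as helper`).

THE MASTER (§2, `hodgeConjectureFor_tensor_of_coniveau_profile`). Let `Y`, `Z` be smooth projective of dimensions `m`, `n` with `HC(Y)`, `HC(Z)`,
and let `cY`, `cZ : ℕ → ℕ` be CONIVEAU PROFILES: `Hᵏ(Y) = N^{cY k} Hᵏ(Y)`, `Hᵏ(Z) = N^{cZ k} Hᵏ(Z)` for all `k`. If for every Künneth slot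
`(i, j)` with `1 ≤ i ≤ m`, `1 ≤ j ≤ n`, `i + j = 2(p+1)` one has `cY i + cZ j ≥ p`, then `HC(Y × Z)` holds in every codimension: the tree's
two-factor criterion `BettiUniverse.hodgeConjectureFor_tensor_of_kunneth_pieces_pos_le` leaves exactly those summands, and each is algebraic by
Voisin's 2013 Lemma 2.1 on Künneth pieces (`BettiUniverse.ofRatClass_crossMap_mem_algebraicClasses_of_supportedClasses_eq_top`: a Hodge class
of `Hⁱ(Y) ⊗ Hʲ(Z)` is supported in codimension `≥ cY i + cZ j ≥ p = (codim) − 1`, hence algebraic — Deligne 8.2.8 + Hironaka + the lift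
engine + Lefschetz `(1,1)`, all proved in the tree).

PROFILES (§3). Every `X` of dimension `n` has the free profile `k − n` (`mem_supportedClasses_sub_dim`). The «HALF profile» `k ↦ ⌊k/2⌋` — the
best possible (`N^{⌊k/2⌋+1} Hᵏ = 0` by Hodge type) — holds for: every smooth projective CURVE; every SURFACE with `H² = N¹H²` (`p_g = 0`,
e.g. `CH₀` on a point or a curve); every THREEFOLD with `H² = N¹H²` and `N¹H³ = H³` (e.g. `CH₀` on a point: rationally chain connected
threefolds; uniruled threefolds with `h^{2,0} = 0` granted Debarre). A half-profile variety satisfies `HC` trivially (`N^q H^{2q} = H^{2q}`).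

ADDITIVITY (§1, §4). `N^{min (cY i + cZ j)} Hᵏ(Y × Z) = Hᵏ(Y × Z)` (`supportedClasses_tensor_eq_top_of_profile`); two half profiles give
`⌊k/2⌋ − 1` on the product, and `⌊k/2⌋` in ODD degrees — the one unit is lost exactly on `odd ⊗ odd`. Consequently (§4–§5): **`HC(Y × Z)` for
ANY TWO half-profile varieties** (the slot inequality `⌊i/2⌋ + ⌊j/2⌋ ≥ (i+j)/2 − 1` always holds) and **`HC(X × (Y × Z))` for ANY THREE**
(`⌊i/2⌋ + c_{Y×Z}(j) ≥ p` because `Y × Z` keeps the half profile in odd degrees); at FOUR factors the slot `H^{odd} ⊗ H^{odd} ⊗ H^{odd} ⊗ H^{odd}`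
(for threefolds: `H³ ⊗ H³ ⊗ H³ ⊗ H³ ⊂ H¹²`, codimension `6`, coniveau `4 < 5`) is the first failure: its Hodge classes are Weil/Hodge-type
tensor classes of the level-one structures `H³(Xᵢ) ≅ H¹(Jᵢ)(−1)`, i.e. the ABELIAN-VARIETY ladder — «RCC-threefold powers meet the abelian
ladder at `n = 4`». Nothing is claimed there.

CONTENT (sorry-free over tree theorems; no definition, no named fact, no new axiom): §1 `supportedClasses_tensor_eq_top_of_slots`,
`supportedClasses_tensor_eq_top_of_profile`; §2 **`hodgeConjectureFor_tensor_of_coniveau_profile`**; §3 profiles `supportedClasses_eq_top_sub_dim`,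
`supportedClasses_curve_eq_top_half`, `supportedClasses_surface_eq_top_half`, `supportedClasses_threefold_eq_top_half`,
`…_of_hasChowZeroSupportedInDimLE_zero`, `hodgeConjectureFor_of_half_profile`; §4 half × half: `supportedClasses_tensor_eq_top_half_sub_one`,
`supportedClasses_tensor_eq_top_half_of_odd`, **`hodgeConjectureFor_tensor_of_half_profiles`**; §5 three factors:
**`hodgeConjectureFor_tensor_tensor_of_half_profiles`**; §6 INSTANCES: **`hodgeConjectureFor_tensor_tensor_threefolds_of_isRationallyChainConnected`**
(ANY THREE rationally chain connected threefolds — UNCONDITIONAL), **`hodgeConjectureFor_cube_of_isRationallyChainConnected`** (`X × (X × X)`),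
`hodgeConjectureFor_tensor_tensor_threefolds_of_isFano` (mod KMM), `hodgeConjectureFor_curve_tensor_of_half_profile` /
`hodgeConjectureFor_tensor_curve_tensor_of_half_profiles` (curves times one or two half-profile varieties).

HONEST SCOPE. Unconditional structure theorems; the hypotheses are coniveau identities (geometric input: Bloch–Srinivas for `CH₀`, Lefschetz for
surfaces, or displayed). Four-factor products and any slot `odd ⊗ odd ⊗ odd ⊗ odd` are OUT of reach of this method (abelian ladder). Nothing
here proves HC / HC_AV in general; rung F-H1 not moved.

## References

* [Voisin2013GHCBloch] C. Voisin, The generalized Hodge and Bloch conjectures are equivalent for general complete intersections (2013), Lemma 2.1.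
* [Voisin2025] C. Voisin, Cycle classes on algebraic varieties (2025), §2.1, Cor. 2.12, §4.1 Def. 4.1, §4.3.
* [VoisinHodgeI2002] C. Voisin, Hodge Theory and Complex Algebraic Geometry I (2002), §6.2.3 Thm. 6.25, §11.3.3 Thm. 11.38–11.41.
* [GrothendieckTopology1969] A. Grothendieck, Hodge's general conjecture is false for trivial reasons, Topology 8 (1969), §1.
* [DeligneHodgeIII1974] P. Deligne, Théorie de Hodge III (1974), Cor. 8.2.8.
* [BlochSrinivas1983] S. Bloch, V. Srinivas, Remarks on correspondences and algebraic cycles (1983), Thm. 1.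
* [Kollar1995] J. Kollár, Rational curves on algebraic varieties (1996), Def. IV.3.2 / 4.10.
* [KollarMiyaokaMori1992] J. Kollár, Y. Miyaoka, S. Mori, J. Differential Geom. 36 (1992), Thm. 0.1.
-/

set_option linter.dupNamespace false

noncomputable section

open CategoryTheory AlgebraicGeometry MonoidalCategory CartesianMonoidalCategory Finset
open scoped TensorProduct
open Literature.AlgebraicTopology.SingularHomology
open Literature.AlgebraicGeometry Literature.AlgebraicGeometry.Motives Literature.AlgebraicGeometry.HodgeTheory
open Literature.Barriers.HodgeConjecture
open Summit.HodgeConjecture.HodgeConjecture.Theorems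

namespace Summit.HodgeConjecture.HodgeConjecture.Theorems.ThreefoldSquare

variable {l m n : ℕ} {X Y Z S C : SchemeOver ℂ}

/-! ## §1 Additivity of coniveau on products -/

/-- **Coniveau slot lemma**: if for every splitting `i + j = k` one factor `Hⁱ(Y)` / `Hʲ(Z)` vanishes or `Hⁱ(Y) = Nʳ Hⁱ`, `Hʲ(Z) = Nˢ Hʲ` with
`r + s ≥ c`, then `Hᵏ(Y × Z) = Nᶜ Hᵏ(Y × Z)` (Künneth spanning `kunnethSpan_complexBetti`; `pr₁^* a ∪ pr₂^* b ∈ N^{r+s}`,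
`cupProduct_map_fst_map_snd_mem_supportedClasses`). [cite: Voisin2025, §4.1 Def. 4.1 and §4.3 (first paragraph)] [cite: GrothendieckTopology1969, §1]
[cite: VoisinHodgeI2002, §11.3.3 Thm. 11.38] -/
theorem supportedClasses_tensor_eq_top_of_slots (hY : IsSmoothProjective m Y) (hZ : IsSmoothProjective n Z) (k c : ℕ)
    (h : ∀ i j : ℕ, i + j = k →
      Subsingleton (complexBetti Y i) ∨ Subsingleton (complexBetti Z j) ∨
        ∃ r s : ℕ, c ≤ r + s ∧ supportedClasses Y i r = ⊤ ∧ supportedClasses Z j s = ⊤) :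
    supportedClasses (Y ⊗ Z) k c = ⊤ := by
  refine eq_top_iff.2 fun z _ ↦ (Submodule.span_le.2 ?_) (kunnethSpan_complexBetti hY hZ k z)
  rintro v ⟨i, j, hij, a, b, rfl⟩
  rcases h i j hij with hi | hj | ⟨r, s, hc, hr, hs⟩
  · rw [Subsingleton.elim a 0, map_zero, LinearMap.map_zero₂]
    exact Submodule.zero_mem _
  · rw [Subsingleton.elim b 0, map_zero, map_zero]
    exact Submodule.zero_mem _
  · have ha : a ∈ supportedClasses Y i r := by rw [hr]; exact Submodule.mem_top
    have hb : b ∈ supportedClasses Z j s := by rw [hs]; exact Submodule.mem_top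
    exact supportedClasses_mono _ k hc (cupProduct_map_fst_map_snd_mem_supportedClasses hY hZ hij ha hb)

/-- **Additivity of coniveau profiles**: if `Hᵏ(Y) = N^{cY k}` and `Hᵏ(Z) = N^{cZ k}` for all `k`, then `Hᵏ(Y × Z) = Nᶜ` for every `c` with
`c ≤ cY i + cZ j` on all slots `i + j = k`. [cite: Voisin2025, §4.1 Def. 4.1 and §4.3] [cite: GrothendieckTopology1969, §1] -/
theorem supportedClasses_tensor_eq_top_of_profile (hY : IsSmoothProjective m Y) (hZ : IsSmoothProjective n Z) (cY cZ : ℕ → ℕ)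
    (hcY : ∀ k, supportedClasses Y k (cY k) = ⊤) (hcZ : ∀ k, supportedClasses Z k (cZ k) = ⊤) (k c : ℕ)
    (h : ∀ i j : ℕ, i + j = k → c ≤ cY i + cZ j) : supportedClasses (Y ⊗ Z) k c = ⊤ :=
  supportedClasses_tensor_eq_top_of_slots hY hZ k c fun i j hij ↦ Or.inr (Or.inr ⟨cY i, cZ j, h i j hij, hcY i, hcZ j⟩)

/-! ## §2 The master theorem -/

/-- **THE ADDITIVE-CONIVEAU PRODUCT THEOREM.** Let `Y`, `Z` be smooth projective of dimensions `m`, `n` satisfying `HC`, with coniveau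
profiles `cY`, `cZ` (`Hᵏ(Y) = N^{cY k} Hᵏ(Y)`, `Hᵏ(Z) = N^{cZ k} Hᵏ(Z)`). If `cY i + cZ j ≥ p` on every Künneth slot `1 ≤ i ≤ m`, `1 ≤ j ≤ n`,
`i + j = 2(p+1)`, then **`HC(Y × Z)` holds in every codimension**: those are exactly the summands the tree's two-factor criterion leaves, and on
each the Hodge classes are supported in codimension `≥ (codim) − 1`, hence algebraic by Voisin's lemma on pieces. (statement: cell hodge-nonav
target (xiii); a packaging of Voisin 2013 Lemma 2.1 + the Künneth formalism, not in print in this form) [cite: Voisin2013GHCBloch, Lemma 2.1]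
[cite: VoisinHodgeI2002, §11.3.3 Thm. 11.38–11.41] [cite: Voisin2025, Cor. 2.12 and §4.1 Def. 4.1] [cite: DeligneHodgeIII1974, Cor. 8.2.8] -/
theorem hodgeConjectureFor_tensor_of_coniveau_profile (hY : IsSmoothProjective m Y) (hZ : IsSmoothProjective n Z) {d : ℕ}
    (hYZ : IsSmoothProjective d (Y ⊗ Z)) (hHY : HodgeConjectureFor m Y) (hHZ : HodgeConjectureFor n Z) (cY cZ : ℕ → ℕ)
    (hcY : ∀ k, supportedClasses Y k (cY k) = ⊤) (hcZ : ∀ k, supportedClasses Z k (cZ k) = ⊤)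
    (hsum : ∀ i j p : ℕ, 1 ≤ i → i ≤ m → 1 ≤ j → j ≤ n → i + j = 2 * (p + 1) → p ≤ cY i + cZ j) :
    HodgeConjectureFor d (Y ⊗ Z) := by
  haveI : HodgeTensorFacts.{0, 0} := hodgeTensorFacts_holds
  have hHD : exists_isReal_hodgeModel := exists_isReal_hodgeModel_holds
  refine BettiUniverse.hodgeConjectureFor_tensor_of_kunneth_pieces_pos_le hHD hY hZ hYZ hHY hHZ
    fun c i j hij hi1 hi hj1 hj hc2 t ht ↦ ?_
  obtain ⟨p, rfl⟩ : ∃ p, c = p + 1 := ⟨c - 1, by omega⟩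
  exact BettiUniverse.ofRatClass_crossMap_mem_algebraicClasses_of_supportedClasses_eq_top hHD hY hZ hYZ hij
    (hsum i j p hi1 hi hj1 hj hij) (hcY i) (hcZ j) ht

/-! ## §3 Profiles -/

/-- **The free profile**: `Hᵏ(X) = N^{k−n} Hᵏ(X)` for `X` smooth projective of dimension `n` (`mem_supportedClasses_sub_dim`).
[cite: Voisin2025, §4.3 (first paragraph)] [cite: GrothendieckTopology1969, §1] -/
theorem supportedClasses_eq_top_sub_dim (hX : IsSmoothProjective n X) (k : ℕ) : supportedClasses X k (k - n) = ⊤ :=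
  eq_top_iff.2 fun x _ ↦ mem_supportedClasses_sub_dim hX x

/-- **Every smooth projective CURVE has the half profile `Hᵏ = N^{⌊k/2⌋} Hᵏ`.** [cite: Voisin2025, §4.3] [cite: GrothendieckTopology1969, §1] -/
theorem supportedClasses_curve_eq_top_half (hC : IsSmoothProjective 1 C) (k : ℕ) : supportedClasses C k (k / 2) = ⊤ := by
  rcases Nat.lt_or_ge k 2 with hk | hk
  · interval_cases k
    · exact supportedClasses_zero C 0
    · exact supportedClasses_zero C 1
  · exact eq_top_iff.2 fun x _ ↦ supportedClasses_mono _ k (by omega) (mem_supportedClasses_sub_dim hC x)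

/-- **A smooth projective SURFACE with `H²(S) = N¹H²(S)` (`p_g = 0`) has the half profile.** [cite: Voisin2025, §4.3] [cite: GrothendieckTopology1969, §1] -/
theorem supportedClasses_surface_eq_top_half (hS : IsSmoothProjective 2 S) (h₂ : algebraicClasses S 1 = ⊤) (k : ℕ) :
    supportedClasses S k (k / 2) = ⊤ := by
  rcases Nat.lt_or_ge k 3 with hk | hk
  · interval_cases k
    · exact supportedClasses_zero S 0
    · exact supportedClasses_zero S 1
    · exact h₂
  · exact eq_top_iff.2 fun x _ ↦ supportedClasses_mono _ k (by omega) (mem_supportedClasses_sub_dim hS x)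

/-- **A smooth projective THREEFOLD with `H²(X) = N¹H²(X)` and `N¹H³(X) = H³(X)` has the half profile** (`H⁴ = N²` by hard Lefschetz,
`algebraicClasses_eq_top_of_eq_top_of_add_eq_dim`; `H⁵`, `H⁶` by the free profile). [cite: VoisinHodgeI2002, §6.2.3 Thm. 6.25]
[cite: Voisin2025, §4.3] -/
theorem supportedClasses_threefold_eq_top_half (hX : IsSmoothProjective 3 X) (h₂ : algebraicClasses X 1 = ⊤)
    (h₃ : supportedClasses X 3 1 = ⊤) (k : ℕ) : supportedClasses X k (k / 2) = ⊤ := by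
  have h₄ : algebraicClasses X 2 = ⊤ :=
    algebraicClasses_eq_top_of_eq_top_of_add_eq_dim hX (p := 1) (q := 2) (by norm_num) (by norm_num) h₂
  rcases Nat.lt_or_ge k 5 with hk | hk
  · interval_cases k
    · exact supportedClasses_zero X 0
    · exact supportedClasses_zero X 1
    · exact h₂
    · exact h₃
    · exact h₄
  · exact eq_top_iff.2 fun x _ ↦ supportedClasses_mono _ k (by omega) (mem_supportedClasses_sub_dim hX x)

/-- **`CH₀` on a point gives the half profile** for surfaces and threefolds (Bloch–Srinivas: `H² = N¹H²`, and `N¹H³ = H³` in dimension `3`).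
[cite: BlochSrinivas1983, Thm. 1] [cite: VoisinHodgeII2003, Thm. 10.17 and Cor. 10.18] -/
theorem supportedClasses_threefold_eq_top_half_of_hasChowZeroSupportedInDimLE_zero (hX : IsSmoothProjective 3 X)
    (hW : HasChowZeroSupportedInDimLE X 0) (k : ℕ) : supportedClasses X k (k / 2) = ⊤ :=
  supportedClasses_threefold_eq_top_half hX (algebraicClasses_one_eq_top_of_hasChowZeroSupportedInDimLE_zero hX hW)
    (supportedClasses_eq_top_of_hasChowZeroSupportedInDimLE_of_lt hX hW (by norm_num)) k

/-- The surface case: `CH₀(S)` on a point ⟹ half profile. [cite: BlochSrinivas1983, Thm. 1] [cite: VoisinHodgeII2003, Cor. 10.18] -/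
theorem supportedClasses_surface_eq_top_half_of_hasChowZeroSupportedInDimLE_zero (hS : IsSmoothProjective 2 S)
    (hW : HasChowZeroSupportedInDimLE S 0) (k : ℕ) : supportedClasses S k (k / 2) = ⊤ :=
  supportedClasses_surface_eq_top_half hS (algebraicClasses_one_eq_top_of_hasChowZeroSupportedInDimLE_zero hS hW) k

/-- **A half-profile variety satisfies the Hodge conjecture** (`H^{2q} = N^q H^{2q}`: every class is algebraic). [cite: Voisin2013GHCBloch, Lemma 2.1]
[cite: GrothendieckTopology1969, p. 301] -/
theorem hodgeConjectureFor_of_half_profile (hX : IsSmoothProjective n X) (hc : ∀ k, supportedClasses X k (k / 2) = ⊤) :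
    HodgeConjectureFor n X := by
  refine hodgeConjectureFor_of_forall_supportedClasses_eq_top hX fun p ↦ eq_top_iff.2 fun x _ ↦ ?_
  have hx : x ∈ supportedClasses X (2 * (p + 1)) (2 * (p + 1) / 2) := by rw [hc]; exact Submodule.mem_top
  exact supportedClasses_mono _ _ (by omega) hx

/-! ## §4 Two half-profile factors -/

/-- **`Hᵏ(Y × Z) = N^{⌊k/2⌋−1} Hᵏ` for two half-profile varieties** (the unit is lost on `odd ⊗ odd`). [cite: Voisin2025, §4.1 Def. 4.1 and §4.3] -/
theorem supportedClasses_tensor_eq_top_half_sub_one (hY : IsSmoothProjective m Y) (hZ : IsSmoothProjective n Z)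
    (hcY : ∀ k, supportedClasses Y k (k / 2) = ⊤) (hcZ : ∀ k, supportedClasses Z k (k / 2) = ⊤) (k : ℕ) :
    supportedClasses (Y ⊗ Z) k (k / 2 - 1) = ⊤ :=
  supportedClasses_tensor_eq_top_of_profile hY hZ _ _ hcY hcZ k _ fun i j hij ↦ by omega

/-- **`Hᵏ(Y × Z) = N^{⌊k/2⌋} Hᵏ` in ODD degrees `k`** for two half-profile varieties. [cite: Voisin2025, §4.1 Def. 4.1 and §4.3] -/
theorem supportedClasses_tensor_eq_top_half_of_odd (hY : IsSmoothProjective m Y) (hZ : IsSmoothProjective n Z)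
    (hcY : ∀ k, supportedClasses Y k (k / 2) = ⊤) (hcZ : ∀ k, supportedClasses Z k (k / 2) = ⊤) (k : ℕ) (hk : Odd k) :
    supportedClasses (Y ⊗ Z) k (k / 2) = ⊤ :=
  supportedClasses_tensor_eq_top_of_profile hY hZ _ _ hcY hcZ k _ fun i j hij ↦ by obtain ⟨l, rfl⟩ := hk; omega

/-- **`HC(Y × Z)` in every codimension for ANY TWO half-profile varieties** (`⌊i/2⌋ + ⌊j/2⌋ ≥ (i+j)/2 − 1` on every slot). Examples: two
rationally chain connected threefolds; an RCC threefold times a curve or a `p_g = 0` surface; two `p_g = 0` surfaces.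
[cite: Voisin2013GHCBloch, Lemma 2.1] [cite: VoisinHodgeI2002, §11.3.3 Thm. 11.38–11.41] -/
theorem hodgeConjectureFor_tensor_of_half_profiles (hY : IsSmoothProjective m Y) (hZ : IsSmoothProjective n Z) {d : ℕ}
    (hYZ : IsSmoothProjective d (Y ⊗ Z)) (hcY : ∀ k, supportedClasses Y k (k / 2) = ⊤) (hcZ : ∀ k, supportedClasses Z k (k / 2) = ⊤) :
    HodgeConjectureFor d (Y ⊗ Z) :=
  hodgeConjectureFor_tensor_of_coniveau_profile hY hZ hYZ (hodgeConjectureFor_of_half_profile hY hcY)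
    (hodgeConjectureFor_of_half_profile hZ hcZ) _ _ hcY hcZ fun i j p _ _ _ _ hij ↦ by omega

/-! ## §5 Three half-profile factors -/

/-- **`HC(X × (Y × Z))` in every codimension for ANY THREE half-profile varieties**: `Y × Z` satisfies `HC` (§4) and keeps the half profile in
odd degrees, `⌊k/2⌋ − 1` in even ones; against the half profile of `X` every slot still satisfies Voisin's inequality. The FOURTH factor fails on
`odd ⊗ odd ⊗ odd ⊗ odd` (see the module docstring: the abelian ladder). [cite: Voisin2013GHCBloch, Lemma 2.1] [cite: VoisinHodgeI2002, §11.3.3 Thm. 11.38–11.41]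
[cite: Voisin2025, §4.3] -/
theorem hodgeConjectureFor_tensor_tensor_of_half_profiles (hX : IsSmoothProjective l X) (hY : IsSmoothProjective m Y)
    (hZ : IsSmoothProjective n Z) {d : ℕ} (hXYZ : IsSmoothProjective d (X ⊗ (Y ⊗ Z)))
    (hcX : ∀ k, supportedClasses X k (k / 2) = ⊤) (hcY : ∀ k, supportedClasses Y k (k / 2) = ⊤)
    (hcZ : ∀ k, supportedClasses Z k (k / 2) = ⊤) : HodgeConjectureFor d (X ⊗ (Y ⊗ Z)) := by
  have hYZ : IsSmoothProjective (m + n) (Y ⊗ Z) := hY.tensor_holds hZ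
  -- the profile of `Y × Z`: `⌊k/2⌋` in odd degrees, `⌊k/2⌋ − 1` in even degrees
  refine hodgeConjectureFor_tensor_of_coniveau_profile hX hYZ hXYZ (hodgeConjectureFor_of_half_profile hX hcX)
    (hodgeConjectureFor_tensor_of_half_profiles hY hZ hYZ hcY hcZ) (fun k ↦ k / 2)
    (fun k ↦ if k % 2 = 1 then k / 2 else k / 2 - 1) hcX (fun k ↦ ?_) fun i j p _ _ _ _ hij ↦ ?_
  · by_cases hk : k % 2 = 1
    · rw [if_pos hk]
      exact supportedClasses_tensor_eq_top_half_of_odd hY hZ hcY hcZ k (Nat.odd_iff.2 hk)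
    · rw [if_neg hk]
      exact supportedClasses_tensor_eq_top_half_sub_one hY hZ hcY hcZ k
  · by_cases hj : j % 2 = 1
    · rw [if_pos hj]; omega
    · rw [if_neg hj]; omega

/-! ## §6 Instances -/

/-- **The product of ANY THREE rationally chain connected smooth projective threefolds satisfies the Hodge conjecture in every codimension —
UNCONDITIONALLY.** [cite: Kollar1995, Def. IV.3.2 (4.10)] [cite: BlochSrinivas1983, Thm. 1] [cite: Voisin2013GHCBloch, Lemma 2.1] -/
theorem hodgeConjectureFor_tensor_tensor_threefolds_of_isRationallyChainConnected (hX : IsSmoothProjective 3 X)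
    (hY : IsSmoothProjective 3 Y) (hZ : IsSmoothProjective 3 Z) (hRX : IsRationallyChainConnected X)
    (hRY : IsRationallyChainConnected Y) (hRZ : IsRationallyChainConnected Z) : HodgeConjectureFor 9 (X ⊗ (Y ⊗ Z)) :=
  hodgeConjectureFor_tensor_tensor_of_half_profiles hX hY hZ (hX.tensor_holds (hY.tensor_holds hZ))
    (supportedClasses_threefold_eq_top_half_of_hasChowZeroSupportedInDimLE_zero hX (hRX.hasChowZeroSupportedInDimLE_zero hX))
    (supportedClasses_threefold_eq_top_half_of_hasChowZeroSupportedInDimLE_zero hY (hRY.hasChowZeroSupportedInDimLE_zero hY))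
    (supportedClasses_threefold_eq_top_half_of_hasChowZeroSupportedInDimLE_zero hZ (hRZ.hasChowZeroSupportedInDimLE_zero hZ))

/-- **The CUBE `X × (X × X)` of a rationally chain connected smooth projective threefold satisfies the Hodge conjecture in every codimension —
UNCONDITIONALLY** (the powers question: `n = 3` reached; `n = 4` meets the abelian ladder at `H³ ⊗ H³ ⊗ H³ ⊗ H³`).
[cite: Kollar1995, Def. IV.3.2 (4.10)] [cite: BlochSrinivas1983, Thm. 1] [cite: Voisin2013GHCBloch, Lemma 2.1] -/
theorem hodgeConjectureFor_cube_of_isRationallyChainConnected (hX : IsSmoothProjective 3 X) (hRX : IsRationallyChainConnected X) :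
    HodgeConjectureFor 9 (X ⊗ (X ⊗ X)) :=
  hodgeConjectureFor_tensor_tensor_threefolds_of_isRationallyChainConnected hX hX hX hRX hRX hRX

/-- **Three smooth Fano threefolds, modulo Kollár–Miyaoka–Mori.** CONDITIONAL on that named fact. [cite: KollarMiyaokaMori1992, Thm. 0.1]
[cite: BlochSrinivas1983, Thm. 1] -/
theorem hodgeConjectureFor_tensor_tensor_threefolds_of_isFano (hK : KollarMiyaokaMori1992_fano_rationallyChainConnected)
    (hFX : IsFano 3 X) (hFY : IsFano 3 Y) (hFZ : IsFano 3 Z) : HodgeConjectureFor 9 (X ⊗ (Y ⊗ Z)) :=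
  hodgeConjectureFor_tensor_tensor_threefolds_of_isRationallyChainConnected hFX.isSmoothProjective hFY.isSmoothProjective
    hFZ.isSmoothProjective (hK hFX) (hK hFY) (hK hFZ)

/-- **Three threefolds with `H² = N¹H²` and `N¹H³ = H³`** (e.g. uniruled with `h^{2,0} = 0`, the hypotheses displayed): `HC(X × (Y × Z))`.
[cite: Voisin2013GHCBloch, Lemma 2.1] [cite: VoisinHodgeI2002, §11.3.3 Thm. 11.38–11.41] -/
theorem hodgeConjectureFor_tensor_tensor_threefolds_of_coniveau (hX : IsSmoothProjective 3 X) (hY : IsSmoothProjective 3 Y)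
    (hZ : IsSmoothProjective 3 Z) (h₂X : algebraicClasses X 1 = ⊤) (h₃X : supportedClasses X 3 1 = ⊤)
    (h₂Y : algebraicClasses Y 1 = ⊤) (h₃Y : supportedClasses Y 3 1 = ⊤) (h₂Z : algebraicClasses Z 1 = ⊤)
    (h₃Z : supportedClasses Z 3 1 = ⊤) : HodgeConjectureFor 9 (X ⊗ (Y ⊗ Z)) :=
  hodgeConjectureFor_tensor_tensor_of_half_profiles hX hY hZ (hX.tensor_holds (hY.tensor_holds hZ))
    (supportedClasses_threefold_eq_top_half hX h₂X h₃X) (supportedClasses_threefold_eq_top_half hY h₂Y h₃Y)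
    (supportedClasses_threefold_eq_top_half hZ h₂Z h₃Z)

/-- **A curve times a half-profile variety** (e.g. `C × Y`, `Y` an RCC threefold): `HC(C × Y)` in every codimension.
[cite: Voisin2013GHCBloch, Lemma 2.1] [cite: VoisinHodgeI2002, §11.3.3 Thm. 11.38–11.41] -/
theorem hodgeConjectureFor_curve_tensor_of_half_profile (hC : IsSmoothProjective 1 C) (hY : IsSmoothProjective m Y)
    (hcY : ∀ k, supportedClasses Y k (k / 2) = ⊤) : HodgeConjectureFor (1 + m) (C ⊗ Y) :=
  hodgeConjectureFor_tensor_of_half_profiles hC hY (hC.tensor_holds hY) (supportedClasses_curve_eq_top_half hC) hcY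

/-- **A curve times a product of two half-profile varieties** (e.g. `C × (Y × Z)` for two RCC threefolds, or `C × (C' × Y)`):
`HC` in every codimension. [cite: Voisin2013GHCBloch, Lemma 2.1] [cite: VoisinHodgeI2002, §11.3.3 Thm. 11.38–11.41] -/
theorem hodgeConjectureFor_curve_tensor_tensor_of_half_profiles (hC : IsSmoothProjective 1 C) (hY : IsSmoothProjective m Y)
    (hZ : IsSmoothProjective n Z) (hcY : ∀ k, supportedClasses Y k (k / 2) = ⊤) (hcZ : ∀ k, supportedClasses Z k (k / 2) = ⊤) :
    HodgeConjectureFor (1 + (m + n)) (C ⊗ (Y ⊗ Z)) :=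
  hodgeConjectureFor_tensor_tensor_of_half_profiles hC hY hZ (hC.tensor_holds (hY.tensor_holds hZ))
    (supportedClasses_curve_eq_top_half hC) hcY hcZ

/-- **Two `p_g = 0` surfaces and an RCC threefold**, `S × (S' × Y)`: `HC` in every codimension (all three factors have the half profile).
[cite: Voisin2013GHCBloch, Lemma 2.1] [cite: BlochSrinivas1983, Thm. 1] -/
theorem hodgeConjectureFor_surfaces_tensor_threefold_of_half_profiles (hS : IsSmoothProjective 2 S) (hS' : IsSmoothProjective 2 Z)
    (hY : IsSmoothProjective 3 Y) (h₂S : algebraicClasses S 1 = ⊤) (h₂S' : algebraicClasses Z 1 = ⊤)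
    (hRY : IsRationallyChainConnected Y) : HodgeConjectureFor 7 (S ⊗ (Z ⊗ Y)) :=
  hodgeConjectureFor_tensor_tensor_of_half_profiles hS hS' hY (hS.tensor_holds (hS'.tensor_holds hY))
    (supportedClasses_surface_eq_top_half hS h₂S) (supportedClasses_surface_eq_top_half hS' h₂S')
    (supportedClasses_threefold_eq_top_half_of_hasChowZeroSupportedInDimLE_zero hY (hRY.hasChowZeroSupportedInDimLE_zero hY))

end Summit.HodgeConjecture.HodgeConjecture.Theorems.ThreefoldSquare

end
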